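import Summits.ResolutionOfSingularities.ResolutionOfSingularities.Theorems.CurveChainCutCells
import Summits.ResolutionOfSingularities.ResolutionOfSingularities.Theorems.FrobeniusLadderFInjectiveMacaulayficationSpreadSupportControl
import Literature.AlgebraicGeometry.Resolution.RegularLocalHeights
import Literature.AlgebraicGeometry.Resolution.PrimeDivisorIdeals
import Literature.AlgebraicGeometry.Resolution.BlowupRelativeDimension
import Literature.AlgebraicGeometry.Resolution.StrictTransformGenericPoint
import Literature.AlgebraicGeometry.Resolution.GermsOfClosedSubsets
import Literature.AlgebraicGeometry.Resolution.MaximalPoints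
import Literature.AlgebraicGeometry.Resolution.StalkSpecializesLocalization
import Literature.AlgebraicGeometry.Resolution.SncStrata
import Literature.AlgebraicGeometry.Resolution.BlowupOffCentre
import HarnessLib

/-! # BirthCountCut — decomp-res-lens-4 g38 node «BirthCountCut» (lane (NP-C‴)(b) of CRITIC row 209 / WINDOW g38, PRE-BUILD
NOTICE INBOX 2026-08-31T11:24:57Z, priced by decomp-res-crit-1 g8's BINDING ANSWER — PRE-RULING STATUS 11:25:54Z, letter row 213b,
conditions (b1)–(b9)): THE LOCATED RESIDUAL CORE C₃♮ʳᶠ («the curve-free ruled-recurrent occult divisorial threefold tower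
following no line», tree `Theorems/CurveChainCutCells`
`WildOccultDivisorialThreefoldNonLineRecurrentCompanionCurveFreeMixedWallFreeFreshJumpShallowCompanionKangarooTowersTerminate n`) CUT BY THE
(β-TAME) BIRTH LETTER (FB) `BirthFreeCompanionTower` — STATED BY MECHANISM:

* the NEAR-BRANCHES of an ideal sheaf `G` at the marked point `x_i` are its PROPER GENERIZATIONS INSIDE THE WEIGHT-`a` LOCUS,
  `brSet T i a G = {η | η ⤳ x_i, η ≠ x_i, ord_η G ≥ a}` (§121; coordinate-free, valid at every point of every tower);
  along a principal companion datum `(m, a, b, H, K)` (`FactorAt`, g35) the branch sets of the factor chain `h_j = facIter T m a H j`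
  are `branchSet T m a H j = brSet T (m+j) a h_j`;
* a near-branch of `h_{j+1}` through `x_{m+j+1}` is BORN AT STEP `j` iff it lies in the exceptional fibre `π⁻¹(x_{m+j})`
  (`BornAt T m a H j`, absolutely `BornAbs T i a G'`);
* (FB) `BirthFreeCompanionTower T := ∃ (m a b H K), FactorAt T m a b H K ∧ 2 ≤ a ∧ (stalkIdeal H x_m).IsPrincipal ∧ ∀ j, ¬ BornAt T m a H j`
  — SOME principal companion of weight `≥ 2` has NO BIRTH AT ANY LATER STEP; its negation (β-wild) «RECURRENT BIRTHS» is unfolded by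
  `not_birthFreeCompanionTower_iff` and, by mechanism, `birthRecurrent_frequently_bornAt` (every principal companion of weight `≥ 2`
  at every stage has births at arbitrarily late steps — re-rooting `bornAt_add_iff`).  THE LETTERS ARE `ncard`-FREE ((b1)): the
  count `μ` appears only in `ℕ∞` (`Set.encard`, junk-free) or under a derived `Set.Finite` ((L1d)).

AND THE BIRTH-COUNT LAW, PROVED IN KERNEL, HYPOTHESIS-FREE AND PORT-FREE (every `p`, every field, EVERY class `P`, every weight
`n`; axioms std): `isolated_or_followsCurve_of_birthFree (T g hB hD) (hocc : ¬ LatentFactorTower T) (h3 : ThreefoldTower T)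
(hFB : BirthFreeCompanionTower T) : IsolatedCompanionTower T ∨ FollowsCurveTower T` — IN AN OCCULT FORCED TOWER OF RING DIMENSION 3
A BIRTH-FREE PRINCIPAL COMPANION EITHER ISOLATES ITS MARKED POINTS FROM SOME STAGE ON (letter (I∞) of g36, BY NAME) OR MAKES THE
TOWER FOLLOW A CURVE GERM (letter (CF∞) of g37, BY NAME); stage form `noTower_occult_threefold_birthFree (n) (P) : NoTower n fun T =>
((((P T ∧ ¬ LatentFactorTower T) ∧ ThreefoldTower T) ∧ ¬ IsolatedCompanionTower T) ∧ ¬ FollowsCurveTower T) ∧ BirthFreeCompanionTower T`,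
wild column `noTowerWild_occult_threefold_birthFree`.  The g36 companion law, the g37 curve law and the g35 line law are NOT
re-applied and NOT re-proved: the law OUTPUTS the letters (I∞)/(CF∞) and the cell's own binders ¬(I∞)/¬(CF∞) close it.
PROOF = FOUR KERNEL LEMMA GROUPS, point by point against (b2)/(b3):
(L1) STRUCTURE OF THE NEAR-BRANCHES OF AN OCCULT PRINCIPAL COMPANION IN rd 3 (§122b, `section BranchStructure`): for a datum with
  `h` principal at `x_i`, weight `a ≥ 1`, and a near-branch `η`: (L1a) `𝔭_η ⊂ 𝒪_{x_i}` is NOT principal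
  (`not_isPrincipal_primeOfSpecializes_of_mem_brSet`) — OCCULTNESS IS LOAD-BEARING: were `𝔭_η = (c)`, then `ord_η h ≥ a` in the DVR
  `(𝒪_{x_i})_{𝔭_η}` (Literature `stalkIdeal_map_stalkSpecializes` + `IsLocalization.AtPrime`) gives `c^a ∣ h₀` in the UFD `𝒪_{x_i}`
  (Literature `pow_dvd_of_algebraMap_mem_map_pow`, `uniqueFactorizationMonoid_stalk`), the spread `S ∋ c` (tree
  `FInjectiveMacaulayfication.SpreadSupportControl.exists_idealSheafData_stalkIdeal_eq`) re-factors `𝓘_i = S^1 · K'` with weight ONE —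
  a LATENT FACTOR, excluded by `occult_letters` (g33) BY NAME; (L1b) hence `height 𝔭_η = 2` (`height_primeOfSpecializes_eq_two_of_mem_brSet`:
  not 0 since `η ≠ x_i` would force `h₀ = 0` against `idealOrder_lt_top_of_stalkIdeal_ne_bot`; not 1 by UFD `isPrincipal_of_height_le_one`;
  not 3 = `height 𝔪` (`height_maximalIdeal_eq_three` ⟸ tree `ringKrullDim_eq_three_of_threefoldTower`) since `𝔭_η ≠ 𝔪` — RING DIMENSION 3
  IS LOAD-BEARING); (L1c) so every near-branch is a MAXIMAL POINT of the closed weight-`a` locus (`brSet_subset_maxPoints`, Literature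
  `MaximalPoints`, `coe_height_primeOfSpecializes`, `Ideal.height_strict_mono_of_isPrime_of_isPrime`) and (L1d) THE BRANCH SET IS FINITE
  (`brSet_finite`: finitely many irreducible components of a closed subset of a Noetherian scheme through a point — Literature
  `GermsOfClosedSubsets` / `SncStrata`); (L1e) `dim 𝒪_{x_i}/𝔭_η = 1` (`ringKrullDim_quotient_primeOfSpecializes_eq_one_of_mem_brSet` ⟸
  Literature `height_add_ringKrullDim_quotient` BY NAME: `2 + dim = 3`); (L1f) an EMPTY branch set isolates `x_i` in the weight-`a`
  locus (`isIsolatedIn_of_brSet_eq_empty`, Literature `GermsOfClosedSubsets`: a closed set with no proper generization of `x` through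
  `x` is `{x}` near `x`).
(L2) THE TRANSPORT LAW, JUNK-FREE AS A MAP STATEMENT (§122a, `section BirthStep`; (b2)): off the births `π_i` MAPS the near-branches of
  `G' = (π_i⁻¹G : E^a)` through `x_{i+1}` INTO those of `G` through `x_i` (`base_mapsTo_brSet_diff` ⟸ `base_mem_brSet_of_ne` ⟸ Literature
  `idealOrder_controlledTransform_of_not_mem` (BlowupOffCentre) + `Specializes.map`) INJECTIVELY (`base_injOn_brSet_diff` ⟸ Literature
  `IsBlowup.existsUnique_preimage_of_not_mem_support` (StrictTransformGenericPoint)); at a BIRTH-FREE step on all of `brSet`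
  (`base_mapsTo_brSet_of_not_bornAbs`, `base_injOn_brSet_of_not_bornAbs`).  COROLLARIES: (β2) `encard_brSet_succ_le_add : μ_{i+1} ≤ μ_i +
  #bornSet_i` in `ℕ∞` with NO hypothesis; (β1) `encard_brSet_succ_le : μ_{i+1} ≤ μ_i` off births; under (L1d)'s finiteness
  `ncard_brSet_succ_le` / `brSet_succ_finite`, and AT EQUALITY OF COUNTS the transport is ONTO: `exists_preimage_of_ncard_eq` (every
  near-branch downstairs is hit — `Set.surj_on_of_inj_on_of_ncard_le`).
(L3) RE-ROOTING AS LEMMAS (§121b, `section BirthShift`; the letter is ONE-parameter, absolutely indexed, no casts in signatures):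
  `facIter_add_heq` (`facIter` from stage `m + j₀` IS `facIter` from `m`, re-indexed — `HEq` along `m + j₀ + j = m + (j₀ + j)`),
  `bornAt_add_iff`, `ncard_branchSet_add`, `branchSet_finite_add_iff`, `birthFree_add` (birth-freeness persists under re-rooting); the
  re-rooted datum is again a principal `FactorAt` datum of weight `a` by the g35/g36 transport lemmas BY NAME (`FactorAt.forcing`,
  `FactorAt.principal_facIter`).
(L4) THE DICHOTOMY (§122c, `section BirthLaw`; (b3)): `μ_j := ncard (branchSet j)` is finite-valued by (L1d) and ANTITONE by (β1), so it
  STABILISES (`Function.argmin` — eventual constancy of an antitone ℕ-sequence, `hconst`); RE-ROOT at the stabilisation stage `m₁ = m + j₁`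
  ((L3)).  `μ ≡ 0` ⇒ every branch set of the re-rooted datum is EMPTY ⇒ by (L1f) and `mem_support_companionMarked_iff` (g36) every marked
  point is isolated in `supp (companionMarked …)` ⇒ `IsolatedCompanionTower T` BY NAME.  `μ ≡ c ≥ 1` ⇒ by (L2) every transport is a
  BIJECTION, so an ACTUAL KERNEL RECURSION (`followsCurveTower_of_branch_chain`: `Nat.leRec` on the UNIQUE preimage, `Classical.choice`
  only — std axioms) builds from one near-branch `η₀` at `x_{m₁}` a chain of points `ζ_i ⤳ x_i`, `ζ_i ≠ x_i`, `π_i ζ_{i+1} = ζ_i`; their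
  primes `𝔮_i := primeOfSpecializes (ζ_i ⤳ x_i) ⊂ 𝒪_{x_i} = lineRing T i 0` are prime, non-maximal
  (`primeOfSpecializes_ne_maximalIdeal_of_ne`), COMPATIBLE `φ_i⁻¹ 𝔮_{i+1} = 𝔮_i` (`comap_stalkMapCongr_primeOfSpecializes` ⟸ Literature
  `comap_stalkMap_primeOfSpecializes` BY NAME, through g35's `lineMap = stalkMapCongr`), of dimension one at `m₁` by (L1e) ⇒
  `FollowsCurveTower T` BY NAME.
THE DECLARED DEPENDENCE (I∞) ⇒ (FB) IS A THEOREM (`birthFree_of_isolatedCompanionTower`, pure topology: a proper generization of `x`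
meets every open neighbourhood of `x`, so an isolated companion has no near-branches at all, hence no births) — it only says that
the birth-recurrent remainder inherits ¬(I∞); the (FB)-half is NOT decided by it (Probe: (FB) ⇏ (I∞), (FB) ⇏ (CF∞), (CF∞) ⇏ (FB),
(FB) ⇏ (L∞), (L∞) ⇏ (FB) must-fail; «C₃♮ʳᶠ ∧ (FB) ⇒ False» must-fail BEFORE the law in-file and closed AFTER it as control).

Then THE CUT OF THE CORE C₃♮ʳᶠ EXACTLY (excluded middle on the letter, `noTowerWild_split`) into
  C₃♮ʳᶠ♭ = C₃♮ʳᶠ ∧ (FB)  — DECIDED: EMPTY, HYPOTHESIS-FREE, PORT-FREE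
                  (`wildOccultDivisorialThreefoldNonLineRecurrentCompanionCurveFreeBirthFreeMixed_holds`; indeed (FB) is killed for ANY class
                  of occult rd-3 towers isolating no companion and following no curve, `wildOccultThreefoldBirthFree_holds (n) (P)`),
  C₃♮ʳᶠ♯ = C₃♮ʳᶠ ∧ ¬(FB) — UNDECIDED · IDEA-NEEDED: «THE BIRTH-RECURRENT CURVE-FREE OCCULT THREEFOLD TOWER» — the new LOCATED RESIDUAL of
                  the column by name `NoWildOccultBirthRecurrentCurveFreeCompanionNonLineMixedTowers` = (C₃♮ʳᶠ♯ ∧ C₄) ∧ D₄,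
with the exact re-locations `…_iff_g38` of C₃♮ʳᶠ, C₃♮ʳ and of the g37/g36 located residuals (HYPOTHESIS-FREE) and `…_iff_g38_of_port` of
C₃♮, C₃, C and of the g35 / g34 / g33 / g32 / g31 residuals (the port `h640` is INHERITED from the g36/g35 re-locations and carried
explicitly; nothing new uses it), down-links hypothesis-free (from g37 / g36 / g35 / g34 / g32 / the aside), up-links to g37 / g36
hypothesis-free.  ROOT BY NAME ((b8)): the new located residual feeds the existing `closes_*` chain through
`noWildOccultCurveFreeRecurrentCompanionNonLineMixedTowers_of_g38` — binders unchanged but for the renamed residual.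

THE NAMED OBSTRUCTION OF THE RESIDUAL — (β3)/(β3′) «RE-INITIALISATION AT BIRTHS» (honest paragraph, (b6)).  What is NEW here: a
TYPED, COORDINATE-FREE BRANCH COUNT `μ` for ARBITRARY forced point-blow-up towers with (β1) «no increase off births» and (β2)
«increase only by the born branches, injective transport of the others» PROVED IN KERNEL, and the kill of the birth-free regime by
stabilisation + transport.  What RESISTS is exactly (β3): when a near-branch IS born (a new exceptional curve of the weight-`a`
locus of the companion through the new marked point, inside `π⁻¹(x)`), `μ` may jump up and nothing on record makes a SECONDARY
quantity drop AT births under POINT blow-ups.  In the literature this is the moment where the strategy CHANGES THE CENTRE: Cossart–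
Jannsen–Saito (LNM 2270, 2020) control the analogous number `β(f,y,u)` (§10, p.125; in prepared coordinates `γ⁻ ≤ β`, p.129 (3);
its behaviour under blowing up, §13 (13.13) p.141: `β′ := β(f′,y′,(u₁,φ′)) ∈ ℤ_{≥0}`, `δ ≥ 2`) only together with Step B «blow up
the permissible CURVE when the old components demand it», and Cossart–Piltant (J. Algebra 529, 2019) handle the companion
polynomial and its exceptional factors (ch. 6, p.408 (6.6)–(6.7); p.412 (6.18)–(6.20)) inside the ω-constant hypersurface case
analysis of ch. 7–9 — neither gives a quantity monotone under the POINT blow-ups a forced tower performs at a birth.  HONESTY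
CLAUSE: this node does NOT assert that (FB) or (β-wild) is inhabited on the core (LESSON 8: the binders are infinite towers; no
inhabitant is certified either way — «recurrent births» is the NAME of ¬(FB), not an existence assertion), nor that births are
«eventually exceptional», nor any bound on the number of births per step ((b7): not typed here, not load-bearing).

WHY (FB) IS NOT LETTERS-EXCLUDED ((b4), accepted): ¬(I∞) gives `branchSet ≠ ∅` infinitely often along every principal companion,
which is compatible by logic both with «no births» (a persistent old branch) and with births; ¬(CF∞)/¬(L∞) speak of ONE germ followed
for ever, (FB) of the exceptional position of components; occult / divisorial / rd 3 constrain the factorisation, not the branch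
dynamics.  That C₃♮ʳᶠ♭ is nevertheless EMPTY is the THEOREM above (finiteness (L1d) from occultness + rd 3, then transport), not a
re-location: Probe §M certifies that the kill is not found by `exact?`/`aesop` before the law and that each of ¬(CF∞), ¬(I∞),
occultness, rd 3 and «not born» is load-bearing.

HONEST TAGS.  DECIDED (hypothesis-free, port-free, kernel): the cell C₃♮ʳᶠ♭.  UNDECIDED · IDEA-NEEDED: C₃♮ʳᶠ♯ (the located core),
C₄, D₄ (and B mod 31571 as before).  COSTUME: none — the `_iff_g38` are logic over the g37 cells plus the one new law;
`not_birthFreeCompanionTower_iff` / `birthRecurrent_frequently_bornAt` are the letter unfolded, not a re-typing.  NOTHING of g32–g37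
is restated: g37 «CurveChainCut» is IN THE TREE (`Theorems/CurveChainCutKernels{,2,3}` + `Theorems/CurveChainCutCells`, landed
2026-08-31) and IMPORTED; this file uses of g35–g37 only `FactorAt`/`facIter`/`FactorAt.forcing`/`FactorAt.principal_facIter`,
`companionMarked`/`mem_support_companionMarked_iff`/`IsolatedCompanionTower`, `lineRing`/`lineMap`/`FollowsCurveTower`, `occult_letters`,
the C₃♮ʳᶠ cell binder and the g37 re-locations, BY NAME; no decl renamed; §0 desk (d5) of `desk/DESK-g38.md` is a root-letters
ANNOTATION only (birth statistics of the small-family replay; no tower, no inhabitant).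
Landing form (four cone-free tree files, cut at the `══ FILE` markers; ns `…Theorems.HugValuationCut`): FILE A
`Theorems/BirthCountCutKernels.lean` = §121–§122a, FILE B `Theorems/BirthCountCutKernels2.lean` = §122a′ (stalk lemmas) + §122b (L1),
FILE C `Theorems/BirthCountCutKernels3.lean` = §122c (the law), FILE D `Theorems/BirthCountCutCells.lean` = §123; each imports the previous
one, FILE A the import list of this node.  No Theses-cone file; no new port, fact or `def : Prop` binder in any law.
Sources: CossartJannsenSaito2020 (LNM 2270) §10 p.125, p.129 (3), §13 (13.13) p.141, and §4 p.58 (old / new boundary components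
`O(x)`, `N(x)` and the transport `O′(x′) = Õ(x) ∩ B′(x′)` for `x′` near `x` — the literature's OLD/BORN bookkeeping, for boundary
components rather than near-branches); CossartPiltant2019 (J. Algebra 529) ch. 6 p.408 (6.6)–(6.7),
p.412 (6.18)–(6.20); CossartPiltant2008 Prop. 4.2 / Lemma 4.3 (the `u`-chart step); Kollar2007 §3.5 (maximal contact fails in
char. p — why the companion is followed by branches, not by a hypersurface); Matsumura1987 Thms. 5.1, 14.2, 17.8, 20.3 (UFD, height +
dimension in regular local rings); GortzWedhorn2020 Prop. B.75 / §5 (generizations and irreducible components). -/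

set_option linter.dupNamespace false
set_option linter.unusedSectionVars false

noncomputable section

open CategoryTheory AlgebraicGeometry IsLocalRing TopologicalSpace
open Literature.AlgebraicGeometry.Resolution
open Summit.ResolutionOfSingularities.ResolutionOfSingularities.Theorems
open WeakOrderReduction ForcedTowerClasses DivergentTowerClasses MonomialTowerClasses
open HugDimensionClasses HugDimensionKernels SurfaceShadowClasses SurfaceShadowKernels
open NearPointCut (SingularClass)
open Scheme.IdealSheafData (vanishingIdeal)

universe u

namespace Summit.ResolutionOfSingularities.ResolutionOfSingularities.Theorems.HugValuationCut

/-! ## ══ FILE A `Theorems/BirthCountCutKernels.lean` (§121–§122a; cone-free; imports = this node's import list) ══ -/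

section BirthLetter

/-! ## §121 (g38 · NEW · LETTER) NEAR-BRANCHES, BIRTHS, AND THE BIRTH-FREE LETTER (FB) -/

/-- **near-branches at an absolute stage**: the PROPER generizations `η` of the marked point `x_i` inside the weight-`a` locus
of an ideal sheaf `G` of stage `i` (`η ⤳ x_i`, `η ≠ x_i`, `ord_η G ≥ a`). -/
def brSet (T : ForcedTower) (i a : ℕ) (G : (T.St i).IdealSheafData) : Set (T.St i) :=
  {η | η ⤳ T.pt i ∧ η ≠ T.pt i ∧ ((a : ℕ) : ℕ∞) ≤ idealOrder G η}

/-- unfolding. [folklore] -/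
theorem mem_brSet_iff (T : ForcedTower) (i a : ℕ) (G : (T.St i).IdealSheafData) (η : T.St i) :
    η ∈ brSet T i a G ↔ η ⤳ T.pt i ∧ η ≠ T.pt i ∧ ((a : ℕ) : ℕ∞) ≤ idealOrder G η := Iff.rfl

/-- **an EXCEPTIONAL near-branch is BORN at step `i`**: a near-branch of `G'` (an ideal sheaf of stage `i + 1`) through
`x_{i+1}` lying over the blown-up point `x_i`, i.e. inside the newest exceptional divisor `π_i⁻¹(x_i)`. -/
def BornAbs (T : ForcedTower) (i a : ℕ) (G' : (T.St (i + 1)).IdealSheafData) : Prop :=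
  ∃ η ∈ brSet T (i + 1) a G', (T.π i).base η = T.pt i

/-- **the near-branches of the companion chain**: `branchSet T m a H j` = the near-branches of `h_j = facIter T m a H j`
through `x_{m+j}`. -/
def branchSet (T : ForcedTower) (m a : ℕ) (H : (T.St m).IdealSheafData) (j : ℕ) : Set (T.St (m + j)) :=
  brSet T (m + j) a (facIter T m a H j)

/-- **a birth along the companion chain at step `j`**: an exceptional near-branch of `h_{j+1}` through `x_{m+j+1}` over
`x_{m+j}`. -/
def BornAt (T : ForcedTower) (m a : ℕ) (H : (T.St m).IdealSheafData) (j : ℕ) : Prop :=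
  BornAbs T (m + j) a (facIter T m a H (j + 1))

/-- **LETTER (FB) «BIRTH-FREE COMPANION» (g38 · structural, by mechanism)**: some PRINCIPAL factor `h` of weight `a ≥ 2` of
the marked stalk at some stage `m` has NO exceptional near-branch born at any later step: every near-branch of every `h_j`
through `x_{m+j}` is transported from stage `m`. -/
def BirthFreeCompanionTower (T : ForcedTower) : Prop :=
  ∃ (m a b : ℕ) (H K : (T.St m).IdealSheafData), FactorAt T m a b H K ∧ 2 ≤ a ∧ (stalkIdeal H (T.pt m)).IsPrincipal ∧
    ∀ j, ¬ BornAt T m a H j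

/-- pure logic: the NEGATION of (FB) — «RECURRENT EXCEPTIONAL BIRTHS»: every principal factor of weight `≥ 2` at every stage
has an exceptional near-branch born at some later step. [folklore] -/
theorem not_birthFreeCompanionTower_iff (T : ForcedTower) :
    ¬ BirthFreeCompanionTower T ↔
      ∀ (m a b : ℕ) (H K : (T.St m).IdealSheafData), FactorAt T m a b H K → 2 ≤ a → (stalkIdeal H (T.pt m)).IsPrincipal →
        ∃ j, BornAt T m a H j := by
  simp only [BirthFreeCompanionTower, not_exists, not_and, not_forall, not_not]

end BirthLetter

section BirthShift

/-! ### §121b re-rooting (index bookkeeping): `facIter` from stage `m + j₀` is `facIter` from stage `m`, re-indexed -/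

/-- congruence of the controlled-transform step under an equality of stage indices. [folklore] -/
theorem controlledTransform_heq_of_heq (T : ForcedTower) (w : ℕ) {i i' : ℕ} (e : i = i')
    {G : (T.St i).IdealSheafData} {G' : (T.St i').IdealSheafData} (h : HEq G G') :
    HEq (controlledTransform (T.π i) (T.centre i) G w) (controlledTransform (T.π i') (T.centre i') G' w) := by
  subst e
  rw [heq_iff_eq] at h
  subst h
  rfl

/-- **re-rooting the factor chain**: `facIter T (m + j₀) w (facIter T m w F j₀) j ≍ facIter T m w F (j₀ + j)`. [folklore] -/
theorem facIter_add_heq (T : ForcedTower) (m w : ℕ) (F : (T.St m).IdealSheafData) (j₀ : ℕ) :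
    ∀ j, HEq (facIter T (m + j₀) w (facIter T m w F j₀) j) (facIter T m w F (j₀ + j))
  | 0 => HEq.rfl
  | j + 1 => controlledTransform_heq_of_heq T w (Nat.add_assoc m j₀ j) (facIter_add_heq T m w F j₀ j)

/-- transport of `brSet` along an index equality. [folklore] -/
theorem brSet_eq_of_heq (T : ForcedTower) (a : ℕ) {i i' : ℕ} (e : i = i') {G : (T.St i).IdealSheafData}
    {G' : (T.St i').IdealSheafData} (h : HEq G G') :
    (brSet T i a G).ncard = (brSet T i' a G').ncard ∧ ((brSet T i a G).Finite ↔ (brSet T i' a G').Finite) ∧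
      (brSet T i a G = ∅ ↔ brSet T i' a G' = ∅) := by
  subst e
  rw [heq_iff_eq] at h
  subst h
  exact ⟨rfl, Iff.rfl, Iff.rfl⟩

/-- transport of `BornAbs` along an index equality. [folklore] -/
theorem bornAbs_iff_of_heq (T : ForcedTower) (a : ℕ) {i i' : ℕ} (e : i = i') {G : (T.St (i + 1)).IdealSheafData}
    {G' : (T.St (i' + 1)).IdealSheafData} (h : HEq G G') : BornAbs T i a G ↔ BornAbs T i' a G' := by
  subst e
  rw [heq_iff_eq] at h
  subst h
  exact Iff.rfl

/-- **births are re-rooting invariant**: `BornAt T (m + j₀) a h_{j₀} j ↔ BornAt T m a H (j₀ + j)`. [folklore] -/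
theorem bornAt_add_iff (T : ForcedTower) (m a : ℕ) (H : (T.St m).IdealSheafData) (j₀ j : ℕ) :
    BornAt T (m + j₀) a (facIter T m a H j₀) j ↔ BornAt T m a H (j₀ + j) :=
  bornAbs_iff_of_heq T a (Nat.add_assoc m j₀ j) (facIter_add_heq T m a H j₀ (j + 1))

/-- **branch counts are re-rooting invariant**. [folklore] -/
theorem ncard_branchSet_add (T : ForcedTower) (m a : ℕ) (H : (T.St m).IdealSheafData) (j₀ j : ℕ) :
    (branchSet T (m + j₀) a (facIter T m a H j₀) j).ncard = (branchSet T m a H (j₀ + j)).ncard :=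
  (brSet_eq_of_heq T a (Nat.add_assoc m j₀ j) (facIter_add_heq T m a H j₀ j)).1

/-- finiteness of branch sets is re-rooting invariant. [folklore] -/
theorem branchSet_finite_add_iff (T : ForcedTower) (m a : ℕ) (H : (T.St m).IdealSheafData) (j₀ j : ℕ) :
    (branchSet T (m + j₀) a (facIter T m a H j₀) j).Finite ↔ (branchSet T m a H (j₀ + j)).Finite :=
  (brSet_eq_of_heq T a (Nat.add_assoc m j₀ j) (facIter_add_heq T m a H j₀ j)).2.1

/-- a birth-free companion datum stays birth-free after re-rooting. [folklore] -/
theorem birthFree_add (T : ForcedTower) (m a : ℕ) (H : (T.St m).IdealSheafData) (h : ∀ j, ¬ BornAt T m a H j) (j₀ : ℕ) :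
    ∀ j, ¬ BornAt T (m + j₀) a (facIter T m a H j₀) j := fun j hb =>
  h (j₀ + j) ((bornAt_add_iff T m a H j₀ j).mp hb)

end BirthShift

section BirthStep

/-! ### §122a (g38 · NEW · KERNEL) THE TRANSPORT LAW — one blow-up step (absolute stage `i`, any ideal sheaf `G`, `G' = (π⁻¹G : E^a)`) -/

variable (T : ForcedTower) [∀ i, IsLocallyNoetherian (T.St i)] (i a : ℕ) (G : (T.St i).IdealSheafData)

/-- off the blown-up point, being outside the centre. [folklore] -/
theorem not_mem_centre_support_of_ne {T : ForcedTower} {i : ℕ} {z : T.St i} (hz : z ≠ T.pt i) :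
    z ∉ ((T.centre i).support : Set (T.St i)) := by
  rw [T.centre_support]
  exact hz

/-- **(β2) TRANSPORT DOWN**: a near-branch of `G'` through `x_{i+1}` that is NOT born (not over `x_i`) maps to a near-branch of
`G` through `x_i` (orders agree off the centre, specialisations map down). [folklore] -/
theorem base_mem_brSet_of_ne {η : T.St (i + 1)}
    (hη : η ∈ brSet T (i + 1) a (controlledTransform (T.π i) (T.centre i) G a)) (hne : (T.π i).base η ≠ T.pt i) :
    (T.π i).base η ∈ brSet T i a G := by
  refine ⟨?_, hne, ?_⟩
  · have h := hη.1.map (T.π i).continuous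
    rwa [T.pt_map] at h
  · rw [← (T.isBlowup i).idealOrder_controlledTransform_of_not_mem G a (not_mem_centre_support_of_ne hne)]
    exact hη.2.2

/-- **off the centre the blow-up is injective on near-branches**. [folklore] -/
theorem base_injOn_brSet_diff :
    Set.InjOn (fun η : T.St (i + 1) => (T.π i).base η)
      {η | η ∈ brSet T (i + 1) a (controlledTransform (T.π i) (T.centre i) G a) ∧ (T.π i).base η ≠ T.pt i} := by
  intro η₁ h₁ η₂ h₂ heq
  obtain ⟨z, -, hz⟩ := (T.isBlowup i).existsUnique_preimage_of_not_mem_support (not_mem_centre_support_of_ne h₁.2)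
  exact (hz η₁ rfl).trans (hz η₂ (by simpa using heq.symm)).symm

/-- **(β2) THE TRANSPORT LAW, JUNK-FREE (map form)**: off the births, `π_i` MAPS the near-branches of the controlled transform
through `x_{i+1}` INTO the near-branches of `G` through `x_i` (Literature `idealOrder_controlledTransform_of_not_mem` — the blow-up
does not change the order off the centre — and `Specializes.map`). [folklore] -/
theorem base_mapsTo_brSet_diff :
    Set.MapsTo (fun η => (T.π i).base η)
      {η | η ∈ brSet T (i + 1) a (controlledTransform (T.π i) (T.centre i) G a) ∧ (T.π i).base η ≠ T.pt i} (brSet T i a G) :=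
  fun _ hη => base_mem_brSet_of_ne T i a G hη.1 hη.2

/-- **(β2) THE TRANSPORT LAW AT A BIRTH-FREE STEP (map form)**: with NO near-branch born at step `i`, `π_i` maps ALL near-branches
through `x_{i+1}` into the near-branches through `x_i` … [folklore] -/
theorem base_mapsTo_brSet_of_not_bornAbs (hb : ¬ BornAbs T i a (controlledTransform (T.π i) (T.centre i) G a)) :
    Set.MapsTo (fun η => (T.π i).base η) (brSet T (i + 1) a (controlledTransform (T.π i) (T.centre i) G a)) (brSet T i a G) :=
  fun η hη => base_mem_brSet_of_ne T i a G hη fun h => hb ⟨η, hη, h⟩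

/-- … INJECTIVELY (Literature `IsBlowup.existsUnique_preimage_of_not_mem_support`: the blow-up is a bijection off the centre).
[folklore] -/
theorem base_injOn_brSet_of_not_bornAbs (hb : ¬ BornAbs T i a (controlledTransform (T.π i) (T.centre i) G a)) :
    Set.InjOn (fun η => (T.π i).base η) (brSet T (i + 1) a (controlledTransform (T.π i) (T.centre i) G a)) :=
  fun η hη η' hη' h => base_injOn_brSet_diff T i a G ⟨hη, fun e => hb ⟨η, hη, e⟩⟩ ⟨hη', fun e => hb ⟨η', hη', e⟩⟩ h

/-- **(β2) THE COUNT LAW, birth-free step**: if no near-branch of `G'` through `x_{i+1}` is born at step `i`, the near-branches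
of `G'` through `x_{i+1}` inject into those of `G` through `x_i`; in particular (finite sets) `μ_{i+1} ≤ μ_i`. [folklore] -/
theorem ncard_brSet_succ_le (hfin : (brSet T i a G).Finite)
    (hb : ¬ BornAbs T i a (controlledTransform (T.π i) (T.centre i) G a)) :
    (brSet T (i + 1) a (controlledTransform (T.π i) (T.centre i) G a)).ncard ≤ (brSet T i a G).ncard := by
  have hne : ∀ η ∈ brSet T (i + 1) a (controlledTransform (T.π i) (T.centre i) G a), (T.π i).base η ≠ T.pt i :=
    fun η hη heq => hb ⟨η, hη, heq⟩
  refine Set.ncard_le_ncard_of_injOn (fun η => (T.π i).base η) (fun η hη => base_mem_brSet_of_ne T i a G hη (hne η hη))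
    (fun η₁ h₁ η₂ h₂ heq => base_injOn_brSet_diff T i a G ⟨h₁, hne η₁ h₁⟩ ⟨h₂, hne η₂ h₂⟩ heq) hfin

/-- birth-free step: the near-branches upstairs are finite if those downstairs are. [folklore] -/
theorem brSet_succ_finite (hfin : (brSet T i a G).Finite)
    (hb : ¬ BornAbs T i a (controlledTransform (T.π i) (T.centre i) G a)) :
    (brSet T (i + 1) a (controlledTransform (T.π i) (T.centre i) G a)).Finite := by
  have hne : ∀ η ∈ brSet T (i + 1) a (controlledTransform (T.π i) (T.centre i) G a), (T.π i).base η ≠ T.pt i :=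
    fun η hη heq => hb ⟨η, hη, heq⟩
  exact Set.Finite.of_injOn (f := fun η => (T.π i).base η) (fun η hη => base_mem_brSet_of_ne T i a G hη (hne η hη))
    (fun η₁ h₁ η₂ h₂ heq => base_injOn_brSet_diff T i a G ⟨h₁, hne η₁ h₁⟩ ⟨h₂, hne η₂ h₂⟩ heq) hfin

/-- **birth-free step with EQUAL counts: every near-branch downstairs is hit** (an injection between finite sets of the same
size is onto). [folklore] -/
theorem exists_preimage_of_ncard_eq (hfin : (brSet T i a G).Finite)
    (hb : ¬ BornAbs T i a (controlledTransform (T.π i) (T.centre i) G a))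
    (heq : (brSet T (i + 1) a (controlledTransform (T.π i) (T.centre i) G a)).ncard = (brSet T i a G).ncard)
    {ζ : T.St i} (hζ : ζ ∈ brSet T i a G) :
    ∃ η ∈ brSet T (i + 1) a (controlledTransform (T.π i) (T.centre i) G a), (T.π i).base η = ζ := by
  have hne : ∀ η ∈ brSet T (i + 1) a (controlledTransform (T.π i) (T.centre i) G a), (T.π i).base η ≠ T.pt i :=
    fun η hη heq => hb ⟨η, hη, heq⟩
  obtain ⟨η, hη, h⟩ := Set.surj_on_of_inj_on_of_ncard_le (fun η _ => (T.π i).base η)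
    (fun η hη => base_mem_brSet_of_ne T i a G hη (hne η hη))
    (fun η₁ η₂ h₁ h₂ heq => base_injOn_brSet_diff T i a G ⟨h₁, hne η₁ h₁⟩ ⟨h₂, hne η₂ h₂⟩ heq) heq.ge hfin ζ hζ
  exact ⟨η, hη, h.symm⟩

end BirthStep

end Summit.ResolutionOfSingularities.ResolutionOfSingularities.Theorems.HugValuationCut
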